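import Summits.CriticalPhenomena.CardyFormulaZ2.Theorems.CardyIKTransportIKLinearTransportScreeningAssemblyDefs
import Summits.CriticalPhenomena.CardyFormulaZ2.Theorems.CardyIKTransportIKLinearTransportScreeningArray
import Summits.CriticalPhenomena.CardyFormulaZ2.Theorems.CardyIKTransportIKMixedBoxCrossingDefectStubRowTwist
import Summits.CriticalPhenomena.CardyFormulaZ2.Theorems.CardyIKTransportIKMixedBoxCrossingDefectStubCondBox
import Summits.CriticalPhenomena.CardyFormulaZ2.Theorems.CardyIKTransportIKLinearTransportStubCouplingToLimitsEvents

/-!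
# `stub_Screening` assembly (crux stmt-CriticalPhenomena-5076, line `pinned-diagram-exchange`) —
# PROBABILITY sub-goals

Support file (`--supports stmt-CriticalPhenomena-5076`) proving the registered sub-goals
`measurable_projEnv`, `measurable_farObs`, `measurable_boxObs`, `integral_env_arr_coins` of the lead's
assembly of `stub_Screening`, over the landed vocabulary of
`…ScreeningAssemblyDefs.lean` (`pcol`, `Qarr`, `Cbox`, `intCells`, `boxCells`, `projEnv`, `farIn`, `farObs`,
`boxObs`) and the array weights `arrWeight` of `…ScreeningArray.lean`.

SETTING. `Ω` = (column signs, row signs, biased plaquettes, fair plaquettes, coins), `μIK` the product of the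
five Bernoulli product measures. The environment `projEnv ω` keeps the signs, the plaquettes OFF the internal
faces `intCells` and the coins OFF the box `boxCells`; the internal plaquette array `Qarr` reads the plaquette
fields ON `intCells`; the box coins `Cbox` read the coin field ON `boxCells`. These are DISJOINT coordinate
sets of independent Bernoulli fields, so (environment) ⊥ (array, coins) (`RowTwistStub.indepFun_proj`), and
the joint law of (array, coins) is the explicit product of cylinder probabilities
(`CondBoxStub.real_inter_eq_mul`, `CondBoxStub.sitePercolation_real_cylinder`): `P(Qarr = q) = arrWeight pcol q`,
`P(Cbox = cc) = 2^{-wh}`. Integrating the discrete coordinates out is then a finite sum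
(`IndepFun.integral_fun_comp_mul_comp`).
-/

noncomputable section

namespace Summit.CriticalPhenomena.CardyFormulaZ2.Theorems.IKLinearTransport.PinnedDiagramExchange.ScreeningAssembly

open scoped Classical symmDiff BigOperators
open MeasureTheory ProbabilityTheory Set
open Literature.Probability.Percolation Literature.Probability.LatticeModels
open ScreeningGauge ScreeningArray
open CouplingToLimits (isProbabilityMeasure_μIK measurable_xor measurable_card_filter measurable_mem_parSet)
open Summit.CriticalPhenomena.CardyFormulaZ2.Cruxes.IKMixedBoxCrossing.DefectClosureExploration.RowTwistStub
  (indepFun_proj)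
open Summit.CriticalPhenomena.CardyFormulaZ2.Cruxes.IKMixedBoxCrossing.DefectClosureExploration.CondBoxStub
  (sitePercolation_real_cylinder real_inter_eq_mul decide_eq_bool_iff)
open Summit.CriticalPhenomena.CardyFormulaZ2.Cruxes.IKMixedBoxCrossing.XorRectangleFlip.IncrStub (mem_parSet_congr)
open Summit.CriticalPhenomena.CardyFormulaZ2.Cruxes.IKMixedBoxCrossing.PairedMirrorExploration.MirrorRP
  renaming measurable_inter_const → mInter

/-! ## §1 Measurability -/

/-- SUB-GOAL · the environment projection is measurable. [folklore] -/
theorem measurable_projEnv : ∀ (a b : ℤ) (w h n : ℕ), Measurable (projEnv a b w h n) := by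
  intro a b w h n
  exact measurable_fst.prodMk (measurable_snd.fst.prodMk
    (((mInter _).comp measurable_snd.snd.fst).prodMk
      (((mInter _).comp measurable_snd.snd.snd.fst).prodMk ((mInter _).comp measurable_snd.snd.snd.snd))))

/-- The external plaquette parity of a fixed rectangle is a measurable event. [folklore] -/
theorem measurable_outPar (S : Set ℤ) (x₁ x₂ y₁ y₂ : ℤ) (R : Finset (ℤ × ℤ)) :
    Measurable fun ω : Ω => outPar S x₁ x₂ y₁ y₂ ω R := by
  unfold outPar
  exact (measurable_of_countable fun n : ℕ => Odd n).comp
    (measurable_card_filter _ fun f => measurable_mem_parSet S _)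

/-- SUB-GOAL · `farObs` is measurable in `ω`. [folklore] -/
theorem measurable_farObs :
    ∀ (S : Set ℤ) (x₁ x₂ y₁ y₂ : ℤ) (m k : ℕ) (kk : (Fin m → Bool) × (Fin k → Bool)),
      Measurable (fun ω : Ω => farObs S x₁ x₂ y₁ y₂ m k ω kk) := by
  intro S x₁ x₂ y₁ y₂ m k kk
  have h1 : ∀ v : Site 2, Measurable fun ω : Ω => v 0 ∈ ω.1 := fun v =>
    (measurable_set_mem (v 0)).comp measurable_fst
  have h2 : ∀ v : Site 2, Measurable fun ω : Ω => v 1 ∈ ω.2.1 := fun v =>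
    (measurable_set_mem (v 1)).comp measurable_snd.fst
  refine (measurable_set_iff.2 fun v => ?_).prodMk (measurable_set_iff.2 fun f => ?_)
  · exact measurable_xor (h1 v) (measurable_xor (h2 v)
      (measurable_xor (measurable_outPar S x₁ x₂ y₁ y₂ _) measurable_const))
  · exact measurable_const.or ((measurable_set_mem f).comp measurable_snd.snd.snd.snd)

/-- SUB-GOAL · `boxObs` is measurable in `ω`. [folklore] -/
theorem measurable_boxObs :
    ∀ (S : Set ℤ) (x₁ x₂ y₁ y₂ a b : ℤ) (w h : ℕ) (t cc : Fin w × Fin h → Bool),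
      Measurable (fun ω : Ω => boxObs S x₁ x₂ y₁ y₂ a b w h ω t cc) := by
  intro S x₁ x₂ y₁ y₂ a b w h t cc
  have h1 : ∀ v : Site 2, Measurable fun ω : Ω => v 0 ∈ ω.1 := fun v =>
    (measurable_set_mem (v 0)).comp measurable_fst
  have h2 : ∀ v : Site 2, Measurable fun ω : Ω => v 1 ∈ ω.2.1 := fun v =>
    (measurable_set_mem (v 1)).comp measurable_snd.fst
  refine (measurable_set_iff.2 fun v => ?_).prodMk (measurable_set_iff.2 fun f => measurable_const)
  exact Measurable.exists fun ij => measurable_const.and (measurable_xor (h1 v) (measurable_xor (h2 v)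
    (measurable_xor (measurable_outPar S x₁ x₂ y₁ y₂ _) measurable_const)))

/-! ## §2 Independence and the discrete laws -/

/-- `decide` of a measurable predicate is a measurable `Bool`-valued map. [folklore] -/
theorem measurable_decide {X : Type*} [MeasurableSpace X] {P : X → Prop} [DecidablePred P]
    (hP : Measurable P) : Measurable fun x => decide (P x) := by
  refine measurable_to_bool ?_
  have h : (fun x => decide (P x)) ⁻¹' {true} = {x | P x} := Set.ext fun x => by simp
  rw [h]
  exact measurableSet_setOf.2 hP

/-- The internal plaquette array is measurable. [folklore] -/
theorem measurable_Qarr (S : Set ℤ) (x₁ y₁ : ℤ) (m k : ℕ) : Measurable (Qarr S x₁ y₁ m k) :=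
  measurable_pi_iff.2 fun f => by
    dsimp only [Qarr]
    exact measurable_decide (measurable_mem_parSet S _)

/-- The box coins are measurable. [folklore] -/
theorem measurable_Cbox (a b : ℤ) (w h : ℕ) : Measurable (Cbox a b w h) :=
  measurable_pi_iff.2 fun ij => by
    dsimp only [Cbox]
    exact measurable_decide ((measurable_set_mem _).comp measurable_snd.snd.snd.snd)

/-- SUB-GOAL · INDEPENDENCE + DISCRETE LAWS (integrating out the internal plaquettes and the box coins):
for a bounded statistic `H` of (environment, array, coins), measurable in the environment, the `μIK`-integral
of `H (projEnv ω) (Qarr ω) (Cbox ω)` is the integral over the environment of the explicit finite average. [folklore] -/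
theorem integral_env_arr_coins :
    ∀ (S : Set ℤ) (a b : ℤ) (w h n m k : ℕ), m = w + 2 * n - 1 → k = h + 2 * n - 1 → 1 ≤ n →
      ∀ (H : Ω → (Fin m × Fin k → Bool) → (Fin w × Fin h → Bool) → ℝ),
      (∀ q cc, Measurable (fun x => H x q cc)) → (∀ x q cc, 0 ≤ H x q cc ∧ H x q cc ≤ 1) →
      ∫ ω, H (projEnv a b w h n ω) (Qarr S (a - n) (b - n) m k ω) (Cbox a b w h ω) ∂μIK =
        ∫ ω, (∑ q : Fin m × Fin k → Bool, ∑ cc : Fin w × Fin h → Bool,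
          arrWeight (pcol S (a - n) m) q * (1 / 2) ^ (w * h) * H (projEnv a b w h n ω) q cc) ∂μIK := by
  intro S a b w h n m k hm hk _hn H hHm hHb
  haveI := isProbabilityMeasure_μIK
  -- VOCABULARY: internal faces `I`, box `B`, environment `X`, discrete data `Y = (array, coins)`
  set I : Set (Site 2) := intCells (a - n) (a + w + n) (b - n) (b + h + n) with hI
  set B : Set (Site 2) := boxCells a b w h with hB
  set X : Ω → Ω := projEnv a b w h n with hX
  set Y : Ω → (Fin m × Fin k → Bool) × (Fin w × Fin h → Bool) :=
    fun ω => (Qarr S (a - n) (b - n) m k ω, Cbox a b w h ω) with hY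
  have mX : Measurable X := measurable_projEnv a b w h n
  have mY : Measurable Y := (measurable_Qarr S _ _ m k).prodMk (measurable_Cbox a b w h)
  -- the array reads cells of `I`, the coins cells of `B`
  have hcellI : ∀ f : Fin m × Fin k, (![a - n + ((f.1 : ℕ) : ℤ), b - n + ((f.2 : ℕ) : ℤ)] : Site 2) ∈ I := by
    intro f
    have h1 := f.1.2
    have h2 := f.2.2
    simp only [hI, intCells, Set.mem_setOf_eq, Matrix.cons_val_zero, Matrix.cons_val_one, Matrix.cons_val_fin_one]
    omega
  have hcellB : ∀ ij : Fin w × Fin h, (![a + ((ij.1 : ℕ) : ℤ), b + ((ij.2 : ℕ) : ℤ)] : Site 2) ∈ B := by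
    intro ij
    have h1 := ij.1.2
    have h2 := ij.2.2
    simp only [hB, boxCells, Set.mem_setOf_eq, Matrix.cons_val_zero, Matrix.cons_val_one, Matrix.cons_val_fin_one]
    omega
  -- INDEPENDENCE: environment ⊥ (array, coins), as functions of disjoint coordinate projections
  have hind : IndepFun X Y μIK := by
    have h0 := indepFun_proj (A₁ := univ) (A₂ := ∅) (B₁ := univ) (B₂ := ∅) (P₁ := Iᶜ) (P₂ := I)
      (Q₁ := Iᶜ) (Q₂ := I) (C₁ := Bᶜ) (C₂ := B) disjoint_bot_right disjoint_bot_right disjoint_compl_left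
      disjoint_compl_left disjoint_compl_left
    refine (h0.comp measurable_id mY).congr (ae_of_all _ fun ω => ?_) (ae_of_all _ fun ω => ?_)
    · show ((ω.1 ∩ univ, (ω.2.1 ∩ univ, (ω.2.2.1 ∩ Iᶜ, (ω.2.2.2.1 ∩ Iᶜ, ω.2.2.2.2 ∩ Bᶜ)))) : Ω) = X ω
      simp only [Set.inter_univ]
      rfl
    · exact Prod.ext
        (funext fun f => decide_eq_decide.2 (mem_parSet_congr S ⟨fun h => h.1, fun h => ⟨h, hcellI f⟩⟩
          ⟨fun h => h.1, fun h => ⟨h, hcellI f⟩⟩))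
        (funext fun ij => decide_eq_decide.2 ⟨fun h => h.1, fun h => ⟨h, hcellB ij⟩⟩)
  -- THE DISCRETE LAW of (array, coins): cylinders of three different Bernoulli fields
  have hlaw : ∀ (q : Fin m × Fin k → Bool) (cc : Fin w × Fin h → Bool),
      μIK.real (Y ⁻¹' {(q, cc)}) = arrWeight (pcol S (a - n) m) q * (1 / 2) ^ (w * h) := by
    intro q cc
    set EQS : Set Ω := {ω | ∀ f : Fin m × Fin k, a - n + ((f.1 : ℕ) : ℤ) ∈ S →
      ((![a - n + ((f.1 : ℕ) : ℤ), b - n + ((f.2 : ℕ) : ℤ)] : Site 2) ∈ ω.2.2.1 ↔ q f = true)} with hEQS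
    set EQN : Set Ω := {ω | ∀ f : Fin m × Fin k, a - n + ((f.1 : ℕ) : ℤ) ∉ S →
      ((![a - n + ((f.1 : ℕ) : ℤ), b - n + ((f.2 : ℕ) : ℤ)] : Site 2) ∈ ω.2.2.2.1 ↔ q f = true)} with hEQN
    set EC : Set Ω := {ω | ∀ ij : Fin w × Fin h,
      ((![a + ((ij.1 : ℕ) : ℤ), b + ((ij.2 : ℕ) : ℤ)] : Site 2) ∈ ω.2.2.2.2 ↔ cc ij = true)} with hEC
    have hsplit : Y ⁻¹' {(q, cc)} = (EQS ∩ EQN) ∩ EC := by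
      ext ω
      simp only [Set.mem_preimage, Set.mem_singleton_iff, hY, Prod.mk.injEq, funext_iff, Qarr, Cbox,
        decide_eq_bool_iff, Set.mem_inter_iff, hEQS, hEQN, hEC, Set.mem_setOf_eq, plaq, parSet,
        Matrix.cons_val_zero]
      refine and_congr_left' ⟨fun hω => ⟨fun f hs => ?_, fun f hs => ?_⟩, fun hω f => ?_⟩
      · simpa [hs] using hω f
      · simpa [hs] using hω f
      · by_cases hs : a - n + ((f.1 : ℕ) : ℤ) ∈ S
        · simpa [hs] using hω.1 f hs
        · simpa [hs] using hω.2 f hs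
    have mEQS : MeasurableSet EQS := measurableSet_setOf.2 (Measurable.forall fun f => measurable_const.imp
      (((measurable_set_mem _).comp measurable_snd.snd.fst).iff measurable_const))
    have mEQN : MeasurableSet EQN := measurableSet_setOf.2 (Measurable.forall fun f => measurable_const.imp
      (((measurable_set_mem _).comp measurable_snd.snd.snd.fst).iff measurable_const))
    have mEC : MeasurableSet EC := measurableSet_setOf.2 (Measurable.forall fun ij =>
      ((measurable_set_mem _).comp measurable_snd.snd.snd.snd).iff measurable_const)
    have h1 : μIK.real ((EQS ∩ EQN) ∩ EC) = μIK.real (EQS ∩ EQN) * μIK.real EC :=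
      real_inter_eq_mul (A₁ := ∅) (A₂ := ∅) (B₁ := ∅) (B₂ := ∅) (P₁ := univ) (P₂ := ∅) (Q₁ := univ) (Q₂ := ∅)
        (C₁ := ∅) (C₂ := univ) disjoint_bot_left disjoint_bot_left disjoint_bot_right disjoint_bot_right
        disjoint_bot_left (mEQS.inter mEQN) mEC
        (fun ω => and_congr
          (forall_congr' fun f => imp_congr_right fun _ =>
            iff_congr ⟨fun h => h.1, fun h => ⟨h, mem_univ _⟩⟩ Iff.rfl)
          (forall_congr' fun f => imp_congr_right fun _ =>
            iff_congr ⟨fun h => h.1, fun h => ⟨h, mem_univ _⟩⟩ Iff.rfl))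
        (fun ω => forall_congr' fun ij => iff_congr ⟨fun h => h.1, fun h => ⟨h, mem_univ _⟩⟩ Iff.rfl)
    have h2 : μIK.real (EQS ∩ EQN) = μIK.real EQS * μIK.real EQN :=
      real_inter_eq_mul (A₁ := ∅) (A₂ := ∅) (B₁ := ∅) (B₂ := ∅) (P₁ := univ) (P₂ := ∅) (Q₁ := ∅) (Q₂ := univ)
        (C₁ := ∅) (C₂ := ∅) disjoint_bot_left disjoint_bot_left disjoint_bot_right disjoint_bot_left
        disjoint_bot_left mEQS mEQN
        (fun ω => forall_congr' fun f => imp_congr_right fun _ =>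
          iff_congr ⟨fun h => h.1, fun h => ⟨h, mem_univ _⟩⟩ Iff.rfl)
        (fun ω => forall_congr' fun f => imp_congr_right fun _ =>
          iff_congr ⟨fun h => h.1, fun h => ⟨h, mem_univ _⟩⟩ Iff.rfl)
    -- cylinder masses
    have hinj : Function.Injective fun f : Fin m × Fin k =>
        (![a - n + ((f.1 : ℕ) : ℤ), b - n + ((f.2 : ℕ) : ℤ)] : Site 2) := by
      intro f g hfg
      have e0 := congrFun hfg 0
      have e1 := congrFun hfg 1
      simp only [Matrix.cons_val_zero, Matrix.cons_val_one, Matrix.cons_val_fin_one] at e0 e1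
      exact Prod.ext (Fin.ext (by omega)) (Fin.ext (by omega))
    have hcyl : ∀ (pr : Fin m × Fin k → Prop) [DecidablePred pr] (π : Ω → Set (Site 2)) (p : unitInterval),
        MeasurePreserving π μIK (sitePercolation (Site 2) p) →
        μIK.real {ω | ∀ f : Fin m × Fin k, pr f →
          ((![a - n + ((f.1 : ℕ) : ℤ), b - n + ((f.2 : ℕ) : ℤ)] : Site 2) ∈ π ω ↔ q f = true)} =
          ∏ j : {f // pr f}, (if q j then (p : ℝ) else 1 - p) := by
      intro pr _ π p hπ
      rw [← sitePercolation_real_cylinder p (e := fun j : {f // pr f} =>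
          (![a - n + (((j : Fin m × Fin k).1 : ℕ) : ℤ), b - n + (((j : Fin m × Fin k).2 : ℕ) : ℤ)] : Site 2))
          (fun j j' hjj' => Subtype.ext (hinj hjj')) (fun j => q j),
        ← hπ.measureReal_preimage (measurableSet_setOf.2 (Measurable.forall fun j =>
          (measurable_set_mem _).iff measurable_const)).nullMeasurableSet]
      exact congrArg μIK.real (Set.ext fun ω => by simp only [Set.mem_setOf_eq, Set.mem_preimage, Subtype.forall])
    have hπ3 : MeasurePreserving (fun ω : Ω => ω.2.2.1) μIK
        (sitePercolation (Site 2) (Set.projIcc (0 : ℝ) 1 zero_le_one (2 * Real.sqrt 3 - 3))) := by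
      unfold μIK
      exact measurePreserving_fst.comp (measurePreserving_snd.comp measurePreserving_snd)
    have hπ4 : MeasurePreserving (fun ω : Ω => ω.2.2.2.1) μIK (sitePercolation (Site 2) half) := by
      unfold μIK
      exact measurePreserving_fst.comp (measurePreserving_snd.comp (measurePreserving_snd.comp measurePreserving_snd))
    have hπ5 : MeasurePreserving (fun ω : Ω => ω.2.2.2.2) μIK (sitePercolation (Site 2) half) := by
      unfold μIK
      exact measurePreserving_snd.comp (measurePreserving_snd.comp (measurePreserving_snd.comp measurePreserving_snd))
    have hEQSval : μIK.real EQS = ∏ j : {f : Fin m × Fin k // a - n + ((f.1 : ℕ) : ℤ) ∈ S},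
        (if q j then ((Set.projIcc (0 : ℝ) 1 zero_le_one (2 * Real.sqrt 3 - 3) : unitInterval) : ℝ)
          else 1 - ((Set.projIcc (0 : ℝ) 1 zero_le_one (2 * Real.sqrt 3 - 3) : unitInterval) : ℝ)) :=
      hcyl (fun f => a - n + ((f.1 : ℕ) : ℤ) ∈ S) _ _ hπ3
    have hEQNval : μIK.real EQN = ∏ j : {f : Fin m × Fin k // a - n + ((f.1 : ℕ) : ℤ) ∉ S},
        (if q j then ((half : unitInterval) : ℝ) else 1 - ((half : unitInterval) : ℝ)) :=
      hcyl (fun f => a - n + ((f.1 : ℕ) : ℤ) ∉ S) _ _ hπ4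
    have hECval : μIK.real EC = (1 / 2) ^ (w * h) := by
      have hinjC : Function.Injective fun ij : Fin w × Fin h => (![a + ((ij.1 : ℕ) : ℤ), b + ((ij.2 : ℕ) : ℤ)] : Site 2) := by
        intro f g hfg
        have e0 := congrFun hfg 0
        have e1 := congrFun hfg 1
        simp only [Matrix.cons_val_zero, Matrix.cons_val_one, Matrix.cons_val_fin_one] at e0 e1
        exact Prod.ext (Fin.ext (by omega)) (Fin.ext (by omega))
      rw [show EC = (fun ω : Ω => ω.2.2.2.2) ⁻¹' {T | ∀ ij : Fin w × Fin h,
          ((![a + ((ij.1 : ℕ) : ℤ), b + ((ij.2 : ℕ) : ℤ)] : Site 2) ∈ T ↔ cc ij = true)} from rfl,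
        hπ5.measureReal_preimage (measurableSet_setOf.2 (Measurable.forall fun ij =>
          (measurable_set_mem _).iff measurable_const)).nullMeasurableSet,
        sitePercolation_real_cylinder half hinjC cc,
        Finset.prod_congr rfl fun ij _ => show (if cc ij then ((half : unitInterval) : ℝ) else 1 - half) = 1 / 2 by
          cases cc ij <;> norm_num [coe_half],
        Finset.prod_const, Finset.card_univ, Fintype.card_prod, Fintype.card_fin, Fintype.card_fin]
    have hW : arrWeight (pcol S (a - n) m) q =
        (∏ j : {f : Fin m × Fin k // a - n + ((f.1 : ℕ) : ℤ) ∈ S},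
          (if q j then ((Set.projIcc (0 : ℝ) 1 zero_le_one (2 * Real.sqrt 3 - 3) : unitInterval) : ℝ)
            else 1 - ((Set.projIcc (0 : ℝ) 1 zero_le_one (2 * Real.sqrt 3 - 3) : unitInterval) : ℝ))) *
        ∏ j : {f : Fin m × Fin k // a - n + ((f.1 : ℕ) : ℤ) ∉ S},
          (if q j then ((half : unitInterval) : ℝ) else 1 - ((half : unitInterval) : ℝ)) := by
      rw [arrWeight, ← Fintype.prod_subtype_mul_prod_subtype (fun f : Fin m × Fin k => a - n + ((f.1 : ℕ) : ℤ) ∈ S)]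
      exact congrArg₂ (· * ·) (Fintype.prod_congr _ _ fun j => by simp only [pcol, j.2, if_true])
        (Fintype.prod_congr _ _ fun j => by simp only [pcol, j.2, if_false, coe_half])
    rw [hsplit, h1, h2, hEQSval, hEQNval, hECval, hW]
  -- THE KEY IDENTITY for a fixed value `(q, cc)` of the discrete data
  have hkey : ∀ (q : Fin m × Fin k → Bool) (cc : Fin w × Fin h → Bool),
      ∫ ω, H (X ω) q cc * (if Y ω = (q, cc) then (1 : ℝ) else 0) ∂μIK =
        arrWeight (pcol S (a - n) m) q * (1 / 2) ^ (w * h) * ∫ ω, H (X ω) q cc ∂μIK := by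
    intro q cc
    rw [hind.integral_fun_comp_mul_comp (f := fun x => H x q cc) (g := fun y => if y = (q, cc) then (1 : ℝ) else 0)
      mX.aemeasurable mY.aemeasurable (hHm q cc).aestronglyMeasurable (measurable_of_countable _).aestronglyMeasurable]
    have hind' : (fun ω => if Y ω = (q, cc) then (1 : ℝ) else 0) = fun ω => (Y ⁻¹' {(q, cc)}).indicator 1 ω := by
      funext ω
      by_cases hω : Y ω = (q, cc) <;> simp [hω]
    rw [hind', integral_indicator_one (mY (measurableSet_singleton _)), hlaw]
    ring
  -- POINTWISE DECOMPOSITION along the values of the discrete data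
  have hpt : ∀ ω : Ω, H (X ω) (Qarr S (a - n) (b - n) m k ω) (Cbox a b w h ω) =
      ∑ q : Fin m × Fin k → Bool, ∑ cc : Fin w × Fin h → Bool,
        H (X ω) q cc * (if Y ω = (q, cc) then (1 : ℝ) else 0) := by
    intro ω
    rw [← Fintype.sum_prod_type' (fun q cc => H (X ω) q cc * (if Y ω = (q, cc) then (1 : ℝ) else 0))]
    simp only [Prod.mk.eta, mul_ite, mul_one, mul_zero, Finset.sum_ite_eq, Finset.mem_univ, if_true]
    rfl
  -- INTEGRABILITY of the bounded measurable integrands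
  have hint : ∀ (q : Fin m × Fin k → Bool) (cc : Fin w × Fin h → Bool),
      Integrable (fun ω => H (X ω) q cc * (if Y ω = (q, cc) then (1 : ℝ) else 0)) μIK := fun q cc =>
    (integrable_const (1 : ℝ)).mono'
      (((hHm q cc).comp mX).mul ((measurable_of_countable fun y : (Fin m × Fin k → Bool) × (Fin w × Fin h → Bool) =>
        if y = (q, cc) then (1 : ℝ) else 0).comp mY)).aestronglyMeasurable
      (ae_of_all _ fun ω => by
        obtain ⟨h0, h1⟩ := hHb (X ω) q cc
        rw [Real.norm_eq_abs, abs_le]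
        split_ifs <;> simp only [mul_one, mul_zero] <;> constructor <;> linarith)
  have hint' : ∀ (q : Fin m × Fin k → Bool) (cc : Fin w × Fin h → Bool),
      Integrable (fun ω => H (X ω) q cc) μIK := fun q cc =>
    (integrable_const (1 : ℝ)).mono' ((hHm q cc).comp mX).aestronglyMeasurable
      (ae_of_all _ fun ω => by
        obtain ⟨h0, h1⟩ := hHb (X ω) q cc
        rw [Real.norm_eq_abs, abs_le]
        constructor <;> linarith)
  -- ASSEMBLY
  calc ∫ ω, H (X ω) (Qarr S (a - n) (b - n) m k ω) (Cbox a b w h ω) ∂μIK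
      = ∫ ω, ∑ q : Fin m × Fin k → Bool, ∑ cc : Fin w × Fin h → Bool,
          H (X ω) q cc * (if Y ω = (q, cc) then (1 : ℝ) else 0) ∂μIK := integral_congr_ae (ae_of_all _ hpt)
    _ = ∑ q : Fin m × Fin k → Bool, ∑ cc : Fin w × Fin h → Bool,
          ∫ ω, H (X ω) q cc * (if Y ω = (q, cc) then (1 : ℝ) else 0) ∂μIK := by
        rw [integral_finsetSum _ fun q _ => integrable_finsetSum _ fun cc _ => hint q cc]
        exact Finset.sum_congr rfl fun q _ => integral_finsetSum _ fun cc _ => hint q cc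
    _ = ∑ q : Fin m × Fin k → Bool, ∑ cc : Fin w × Fin h → Bool,
          arrWeight (pcol S (a - n) m) q * (1 / 2) ^ (w * h) * ∫ ω, H (X ω) q cc ∂μIK :=
        Finset.sum_congr rfl fun q _ => Finset.sum_congr rfl fun cc _ => hkey q cc
    _ = ∫ ω, (∑ q : Fin m × Fin k → Bool, ∑ cc : Fin w × Fin h → Bool,
          arrWeight (pcol S (a - n) m) q * (1 / 2) ^ (w * h) * H (X ω) q cc) ∂μIK := by
        rw [integral_finsetSum _ fun q _ => integrable_finsetSum _ fun cc _ => (hint' q cc).const_mul _]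
        refine Finset.sum_congr rfl fun q _ => ?_
        rw [integral_finsetSum _ fun cc _ => (hint' q cc).const_mul _]
        exact Finset.sum_congr rfl fun cc _ => (integral_const_mul _ _).symm

end Summit.CriticalPhenomena.CardyFormulaZ2.Theorems.IKLinearTransport.PinnedDiagramExchange.ScreeningAssembly
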